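import Mathlib
import HarnessLib
import Literature.NumberTheory.DiophantineGeometry.ConicChartLocal
import Literature.NumberTheory.DiophantineGeometry.ConicParametrisationCount

/-!
# The height form of the parametrisation: `Z(conicMap (a,b,−c) P (se₁ + te₂))`

For the conic `aX² + bY² = cZ²` projected from `P` with `det(P,e₁,e₂) = 1`, the last coordinate
`q(s,t) = Z(conicMap (a,b,−c) P (se₁+te₂))` is a binary quadratic form
`q = A's² + B'st + C't²` (`zForm_eq`) with

* `zForm_disc` — `B'² − 4A'C' = −4ab`: pull `q` back along the chart `(s,t,0) = kP + s'e₁ + t'e₂`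
  (Cramer), where it becomes `γ(as² + bt²)` (`zForm_chart`), and use the complementary-minor
  identity `m₁₁m₂₂ − m₁₂m₂₁ = γ · det(P,e₁,e₂)` (`minor_det`);
* `zForm_coeff_pos` — `A' > 0` (the form takes the positive value `γ a`), and
  `zForm_pos` — `q(s,t) > 0` for `(s,t) ≠ 0`.

So `q` is positive definite of discriminant `−4ab`: the ellipse `{q ≤ T}` has area `πT/√(ab)`,
the archimedean factor of the conic count (Browning–Van Valckenborgh 2012, §2.3). Everything is
proved (theorems only).

## References

* T. D. Browning, K. Van Valckenborgh, *Sums of three squareful numbers*, Exp. Math. 21 (2012),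
  §2.3, §3. [cite: BrowningValckenborgh2012, §2.3]
-/

namespace Literature.NumberTheory.DiophantineGeometry

section ZForm

variable {A P e₁ e₂ : ℤ × ℤ × ℤ}

/-- **The last coordinate of the parametrisation is a binary quadratic form** in `(s, t)`:
`q(s,t) = q(1,0) s² + (q(1,1) − q(1,0) − q(0,1)) st + q(0,1) t²`. [folklore] -/
theorem zForm_eq (A P e₁ e₂ : ℤ × ℤ × ℤ) (s t : ℤ) :
    (conicMap A P (s • e₁ + t • e₂)).2.2 =
      (conicMap A P ((1 : ℤ) • e₁ + (0 : ℤ) • e₂)).2.2 * s ^ 2 +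
        ((conicMap A P ((1 : ℤ) • e₁ + (1 : ℤ) • e₂)).2.2 -
          (conicMap A P ((1 : ℤ) • e₁ + (0 : ℤ) • e₂)).2.2 -
          (conicMap A P ((0 : ℤ) • e₁ + (1 : ℤ) • e₂)).2.2) * (s * t) +
        (conicMap A P ((0 : ℤ) • e₁ + (1 : ℤ) • e₂)).2.2 * t ^ 2 := by
  simp only [conicMap, ternForm, ternBilin, Prod.fst_add, Prod.snd_add, Prod.smul_fst,
    Prod.smul_snd, smul_eq_mul]
  ring

/-- **Complementary minors**: with `m₁₁ = det(P,(1,0,0),e₂)`, `m₁₂ = det(P,e₁,(1,0,0))`,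
`m₂₁ = det(P,(0,1,0),e₂)`, `m₂₂ = det(P,e₁,(0,1,0))` one has
`m₁₁m₂₂ − m₁₂m₂₁ = P₂ · det(P,e₁,e₂)`. [folklore] -/
theorem minor_det (P e₁ e₂ : ℤ × ℤ × ℤ) :
    idet3 P (1, 0, 0) e₂ * idet3 P e₁ (0, 1, 0) - idet3 P e₁ (1, 0, 0) * idet3 P (0, 1, 0) e₂ =
      P.2.2 * idet3 P e₁ e₂ := by
  simp only [idet3]; ring

/-- **The chart pull-back of the height form**: with the minors above and `det(P,e₁,e₂) = 1`,
`F(P) = 0`, `q(s m₁₁ + t m₂₁, s m₁₂ + t m₂₂) = γ (A₀ s² + A₁ t²)`. [folklore] -/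
theorem zForm_chart (hP : ternForm A P = 0) (he : idet3 P e₁ e₂ = 1) (s t : ℤ) :
    (conicMap A P ((s * idet3 P (1, 0, 0) e₂ + t * idet3 P (0, 1, 0) e₂) • e₁ +
        (s * idet3 P e₁ (1, 0, 0) + t * idet3 P e₁ (0, 1, 0)) • e₂)).2.2 =
      (A.1 * s ^ 2 + A.2.1 * t ^ 2) * P.2.2 := by
  have hx := eq_comb_of_idet3_eq_one he (s, t, 0)
  have e1 : idet3 P (s, t, 0) e₂ = s * idet3 P (1, 0, 0) e₂ + t * idet3 P (0, 1, 0) e₂ := by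
    simp only [idet3]; ring
  have e2 : idet3 P e₁ (s, t, 0) = s * idet3 P e₁ (1, 0, 0) + t * idet3 P e₁ (0, 1, 0) := by
    simp only [idet3]; ring
  set k := idet3 (s, t, 0) e₁ e₂ with hk
  have hu : (s * idet3 P (1, 0, 0) e₂ + t * idet3 P (0, 1, 0) e₂) • e₁ +
      (s * idet3 P e₁ (1, 0, 0) + t * idet3 P e₁ (0, 1, 0)) • e₂ = (s, t, 0) + (-k) • P := by
    rw [← e1, ← e2]
    have h' : k • P + (idet3 P (s, t, 0) e₂ • e₁ + idet3 P e₁ (s, t, 0) • e₂) = (s, t, (0 : ℤ)) := by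
      rw [← add_assoc]; exact hx.symm
    rw [eq_sub_of_add_eq' h', neg_smul, sub_eq_add_neg]
  rw [hu, conicMap_add_zsmul hP, conicMap_chart]

/-- **The discriminant of the height form is `−4 A₀ A₁`** (for `det(P,e₁,e₂) = 1`, `F(P) = 0`,
`P₂ ≠ 0`). [folklore] -/
theorem zForm_disc (hP : ternForm A P = 0) (he : idet3 P e₁ e₂ = 1) (hγ : P.2.2 ≠ 0) :
    ((conicMap A P ((1 : ℤ) • e₁ + (1 : ℤ) • e₂)).2.2 -
        (conicMap A P ((1 : ℤ) • e₁ + (0 : ℤ) • e₂)).2.2 -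
        (conicMap A P ((0 : ℤ) • e₁ + (1 : ℤ) • e₂)).2.2) ^ 2 -
      4 * (conicMap A P ((1 : ℤ) • e₁ + (0 : ℤ) • e₂)).2.2 *
        (conicMap A P ((0 : ℤ) • e₁ + (1 : ℤ) • e₂)).2.2 = -4 * A.1 * A.2.1 := by
  set qA := (conicMap A P ((1 : ℤ) • e₁ + (0 : ℤ) • e₂)).2.2 with hqA
  set qC := (conicMap A P ((0 : ℤ) • e₁ + (1 : ℤ) • e₂)).2.2 with hqC
  set qB := (conicMap A P ((1 : ℤ) • e₁ + (1 : ℤ) • e₂)).2.2 - qA - qC with hqB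
  set m₁₁ := idet3 P (1, 0, 0) e₂
  set m₁₂ := idet3 P e₁ (1, 0, 0)
  set m₂₁ := idet3 P (0, 1, 0) e₂
  set m₂₂ := idet3 P e₁ (0, 1, 0)
  have hform : ∀ s t : ℤ, (conicMap A P (s • e₁ + t • e₂)).2.2 = qA * s ^ 2 + qB * (s * t) + qC * t ^ 2 := by
    intro s t; rw [zForm_eq]
  have E : ∀ s t : ℤ, qA * (s * m₁₁ + t * m₂₁) ^ 2 + qB * ((s * m₁₁ + t * m₂₁) * (s * m₁₂ + t * m₂₂)) +
      qC * (s * m₁₂ + t * m₂₂) ^ 2 = (A.1 * s ^ 2 + A.2.1 * t ^ 2) * P.2.2 := by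
    intro s t; rw [← hform, zForm_chart hP he]
  have E1 := E 1 0
  have E2 := E 0 1
  have E3 := E 1 1
  simp only [one_mul, zero_mul, add_zero, zero_add, one_pow, mul_one] at E1 E2 E3
  have hdet : m₁₁ * m₂₂ - m₁₂ * m₂₁ = P.2.2 := by
    have := minor_det P e₁ e₂; rw [he, mul_one] at this; exact this
  have key : (qB ^ 2 - 4 * qA * qC) * (m₁₁ * m₂₂ - m₁₂ * m₂₁) ^ 2 =
      (2 * qA * m₁₁ * m₂₁ + qB * (m₁₁ * m₂₂ + m₁₂ * m₂₁) + 2 * qC * m₁₂ * m₂₂) ^ 2 -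
        4 * (qA * m₁₁ ^ 2 + qB * (m₁₁ * m₁₂) + qC * m₁₂ ^ 2) *
          (qA * m₂₁ ^ 2 + qB * (m₂₁ * m₂₂) + qC * m₂₂ ^ 2) := by ring
  have hcross : 2 * qA * m₁₁ * m₂₁ + qB * (m₁₁ * m₂₂ + m₁₂ * m₂₁) + 2 * qC * m₁₂ * m₂₂ = 0 := by
    linear_combination E3 - E1 - E2
  rw [hcross, E1, E2, hdet] at key
  have hγ2 : P.2.2 ^ 2 ≠ 0 := pow_ne_zero 2 hγ
  have : (qB ^ 2 - 4 * qA * qC) * P.2.2 ^ 2 = (-4 * A.1 * A.2.1) * P.2.2 ^ 2 := by linear_combination key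
  exact mul_right_cancel₀ hγ2 this

/-- **Positive definiteness of the height form** for `A₀, A₁ > 0`, `P₂ > 0`: the leading
coefficient `q(1,0)` is positive. [folklore] -/
theorem zForm_coeff_pos (hP : ternForm A P = 0) (he : idet3 P e₁ e₂ = 1) (hA0 : 0 < A.1)
    (hA1 : 0 < A.2.1) (hγ : 0 < P.2.2) :
    0 < (conicMap A P ((1 : ℤ) • e₁ + (0 : ℤ) • e₂)).2.2 := by
  set qA := (conicMap A P ((1 : ℤ) • e₁ + (0 : ℤ) • e₂)).2.2 with hqA
  set qC := (conicMap A P ((0 : ℤ) • e₁ + (1 : ℤ) • e₂)).2.2 with hqC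
  set qB := (conicMap A P ((1 : ℤ) • e₁ + (1 : ℤ) • e₂)).2.2 - qA - qC with hqB
  have hdisc : qB ^ 2 - 4 * qA * qC = -4 * A.1 * A.2.1 := zForm_disc hP he hγ.ne'
  -- the value `γ A₀ > 0` at the chart image of `(1, 0)`
  set m₁₁ := idet3 P (1, 0, 0) e₂
  set m₁₂ := idet3 P e₁ (1, 0, 0)
  have hval : qA * m₁₁ ^ 2 + qB * (m₁₁ * m₁₂) + qC * m₁₂ ^ 2 = A.1 * P.2.2 := by
    have E := zForm_chart hP he 1 0
    rw [zForm_eq] at E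
    simp only [one_mul, zero_mul, add_zero, one_pow, mul_one] at E
    linear_combination E
  have hpos : 0 < qA * m₁₁ ^ 2 + qB * (m₁₁ * m₁₂) + qC * m₁₂ ^ 2 := by
    rw [hval]; exact mul_pos hA0 hγ
  -- `4 qA q(s,t) = (2 qA s + qB t)² + 4 A₀A₁ t²`
  have hid : 4 * qA * (qA * m₁₁ ^ 2 + qB * (m₁₁ * m₁₂) + qC * m₁₂ ^ 2) =
      (2 * qA * m₁₁ + qB * m₁₂) ^ 2 + (4 * A.1 * A.2.1) * m₁₂ ^ 2 := by
    linear_combination (-(m₁₂ ^ 2)) * hdisc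
  by_contra h
  push Not at h
  have h4 : 4 * qA * (qA * m₁₁ ^ 2 + qB * (m₁₁ * m₁₂) + qC * m₁₂ ^ 2) ≤ 0 :=
    mul_nonpos_of_nonpos_of_nonneg (by linarith) hpos.le
  rw [hid] at h4
  have hsq : 0 ≤ (2 * qA * m₁₁ + qB * m₁₂) ^ 2 := sq_nonneg _
  have hsq2 : 0 ≤ (4 * A.1 * A.2.1) * m₁₂ ^ 2 := by positivity
  have hm₁₂ : m₁₂ = 0 := by
    by_contra hne
    have : 0 < (4 * A.1 * A.2.1) * m₁₂ ^ 2 := by positivity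
    linarith
  have h2 : (2 * qA * m₁₁ + qB * m₁₂) ^ 2 = 0 := by linarith
  rw [hm₁₂] at h2 hval
  simp only [mul_zero, add_zero, zero_pow two_ne_zero] at h2 hval
  have : 2 * qA * m₁₁ = 0 := pow_eq_zero_iff two_ne_zero |>.1 h2
  have hm : qA * m₁₁ ^ 2 = A.1 * P.2.2 := by linear_combination hval
  have : qA * m₁₁ = 0 := by linarith
  have : qA * m₁₁ ^ 2 = 0 := by rw [pow_two, ← mul_assoc, this, zero_mul]
  rw [this] at hm
  exact absurd hm.symm (mul_pos hA0 hγ).ne'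

/-- **The height form is positive** away from the origin (`A₀, A₁ > 0`, `P₂ > 0`). [folklore] -/
theorem zForm_pos (hP : ternForm A P = 0) (he : idet3 P e₁ e₂ = 1) (hA0 : 0 < A.1)
    (hA1 : 0 < A.2.1) (hγ : 0 < P.2.2) {s t : ℤ} (hst : ¬(s = 0 ∧ t = 0)) :
    0 < (conicMap A P (s • e₁ + t • e₂)).2.2 := by
  set qA := (conicMap A P ((1 : ℤ) • e₁ + (0 : ℤ) • e₂)).2.2 with hqA
  set qC := (conicMap A P ((0 : ℤ) • e₁ + (1 : ℤ) • e₂)).2.2 with hqC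
  set qB := (conicMap A P ((1 : ℤ) • e₁ + (1 : ℤ) • e₂)).2.2 - qA - qC with hqB
  have hdisc : qB ^ 2 - 4 * qA * qC = -4 * A.1 * A.2.1 := zForm_disc hP he hγ.ne'
  have hqApos : 0 < qA := zForm_coeff_pos hP he hA0 hA1 hγ
  have hform : (conicMap A P (s • e₁ + t • e₂)).2.2 = qA * s ^ 2 + qB * (s * t) + qC * t ^ 2 := by
    rw [zForm_eq]
  rw [hform]
  have hid : 4 * qA * (qA * s ^ 2 + qB * (s * t) + qC * t ^ 2) =
      (2 * qA * s + qB * t) ^ 2 + (4 * A.1 * A.2.1) * t ^ 2 := by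
    linear_combination (-(t ^ 2)) * hdisc
  have hnn : 0 ≤ (2 * qA * s + qB * t) ^ 2 + (4 * A.1 * A.2.1) * t ^ 2 := by positivity
  have hne : (2 * qA * s + qB * t) ^ 2 + (4 * A.1 * A.2.1) * t ^ 2 ≠ 0 := by
    intro h0
    have ht : t = 0 := by
      by_contra hne
      have : 0 < (4 * A.1 * A.2.1) * t ^ 2 := by positivity
      nlinarith [sq_nonneg (2 * qA * s + qB * t)]
    rw [ht] at h0
    simp only [mul_zero, add_zero, zero_pow two_ne_zero] at h0
    have hs : 2 * qA * s = 0 := pow_eq_zero_iff two_ne_zero |>.1 h0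
    have : s = 0 := by
      rcases mul_eq_zero.1 hs with h | h
      · exact absurd h (by positivity)
      · exact h
    exact hst ⟨this, ht⟩
  have h4 : 0 < 4 * qA * (qA * s ^ 2 + qB * (s * t) + qC * t ^ 2) := by
    rw [hid]; exact lt_of_le_of_ne hnn (Ne.symm hne)
  have : 0 < 4 * qA := by positivity
  exact pos_of_mul_pos_right h4 this.le |> fun h => by nlinarith [h4, hqApos]

end ZForm

end Literature.NumberTheory.DiophantineGeometry
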